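import Summits.QuantumFields.YangMills.Theorems.BalabanUVNodesN11NoExpansionGeneralStepLawsCoPH
import Literature.MathematicalPhysics.QuantumFieldTheory.Balaban1983to89.Node00.Record13SepCoPHChi
import Literature.MathematicalPhysics.QuantumFieldTheory.Balaban1983to89.Node00.Record13ResidualsRChi
import Summits.QuantumFields.YangMills.Theorems.BalabanUVNodesN11NoExpansionAtRecord13CoPChi
import Summits.QuantumFields.YangMills.Theorems.BalabanUVNodesN11NoExpansionDiagonalCoPHChi
import Summits.QuantumFields.YangMills.Theorems.BalabanUVNodesN11BackgroundScaleLocalChi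
import Summits.QuantumFields.YangMills.Theorems.BalabanUVNodesN11NoExpansionOldFactorsChi
import Literature.MathematicalPhysics.QuantumFieldTheory.Balaban1983to89.B16RLeafRecord13LiveChi

/-!
# χ-GENERIC RE-ISSUE (WORK ORDER RC-1 «RE-CENTRE THE RECORD», director-ym №462 (B) ∕ №467 (D)) of `BalabanUVNodesN11NoExpansionGeneralStepLawsCoPH`

Cell `pub-ymgap` (HUMAN RULING D-0062, Track A), seat `pub-ymgap-dag-n11-d` (N11 [B14] s2; N11-σ campaign, `N11-G44-RC1-REACH-CENSUS.md`).  The CENTRE-TYPED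
declarations of `BalabanUVNodesN11NoExpansionGeneralStepLawsCoPH` (those whose statement reads the (2.9) cut-off centre through `gOfRecord₁₃ ∕ EOfRecord₁₃ ∕ Provisos₁₃… ∕ T∕SLaw₁₃… ∕
UbgOfRecord₁₃… ∕ WtOfRecord₁₃… ∕ datum∕tower∕coreOfRecord₁₃…`) RE-ISSUED VERBATIM in the β-slot `χ : ChiSlot F N` over [Ax-3b]∕[Ax-3c]∕[Ax-3d]'s χ-generic carriers
(`Node00/Record13Chi` ∕ `Record13CoPHChi` ∕ `Record13SepCoPHChi`): σ = (binder `(χ : ChiSlot F N)` after `θ`; Node00 defs `X ↦ XChi … χ`; Node00 rows `Y ↦ Y_chi`;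
this lane's sibling modules `…Chi` for Summits-side dependencies); SAME short names in the sibling namespace `…BalabanUVNodesN11NoExpansionGeneralStepLawsCoPHChi` (consumers switch by namespace);
the 4 centre-FREE declarations of the original are NOT copied — they are reused BY NAME (`open … (…)` below).  At `χ := chiβOfRecord₁₃ θ` every statement here is
DEFINITIONALLY the landed one ([Ax-3b]'s `rfl` receipts); at `χ := chiβOfRecord₁₃Ax θ` it is what the Ax-record's N11 machine reads.  Nothing of record edited (body-freeze №460 (2)).

HONEST FRAMING.  Count-neutral kernel re-elaboration of landed N11 bookkeeping∕estimates in a parameter; every HYPOTHESIS of the original stays a hypothesis; nothing of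
Bałaban asserted beyond what the original file proves; N11 NOT discharged; K-items untouched; counts unmoved.  One finite `𝕋⁴_{L^K}` programme at fixed `ε = L^{−K}` —
NOT ℝ⁴, NOT OS, NOT a mass gap, NOT Clay.  No `sorry`∕`instance`∕`notation`.  Sources: as the original module, plus [I] = [Balaban1987RG1] (2.9) p.266 (the cut-off's centre).
-/

noncomputable section

open MeasureTheory
open scoped BigOperators Matrix.Norms.L2Operator

namespace Summit.QuantumFields.YangMills.Theorems.BalabanUVNodesN11NoExpansionGeneralStepLawsCoPHChi

open Summit.QuantumFields.YangMills.Theorems.BalabanUVNodesN11NoExpansionGeneralStepLawsCoPH (exists_lawsT_clause_succ_CoPH_of_Omega_empty_of_lawsRT_of_clause exists_lawsT_clause_succ_CoPH_of_Omega_empty_of_sLaw₁₃CoPH exists_lawsRT_slotClause_succ_CoPH_of_Omega_empty_of_lawsRT_of_clause_of_liveSel exists_lawsRT_slotClause_succ_CoPH_of_Omega_empty_of_sLaw₁₃CoPH_of_liveSel)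
open Literature.MathematicalPhysics.QuantumFieldTheory.Balaban1983to89 T4Continuum Node00 Node00.Tk DagBinding
open Literature.MathematicalPhysics.QuantumFieldTheory.Balaban1983to89.B16RLeafRecord13LiveGenericZS
open BalabanUVNodesN11NoExpansionActionSucc (seq_init_Ω_eq_of_Omega_empty)
open BalabanUVNodesN11NoExpansionTruncatedWitness (lawsT_towerOfTerms_of_lawsRT_of_agree_of_vanish sect2Slot_succ_congr_of_agree_of_Omega_empty)
open BalabanUVNodesN11NoExpansionGeneralStepCoPH (clause_succ_CoPH_of_Omega_empty_of_pinChi_of_provisos_of_clause)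

/-! ## §2. The v1.7 `CoPH` record, generic `θ : Stage13HParams` — the 𝐓-side law + clause at `s′` from `SLaw_k`, and its reading through 𝐑 on the live-selector line -/

section LawsCoPH

variable {F : T4Family} {N : ℕ} [NeZero N]
variable (θ : Stage13HParams F N) (χ : ChiSlot F N) (p : B12.RunParams)

/-- **THE HISTORY's §2 TOWER AT A NO-EXPANSION `s′` IS THE ONE AT `init s′`** for every term-value witness: `init s′` and `s′` have the same `Ω`-function (dag-n11-d's
`seq_init_Ω_eq_of_Omega_empty`), and 11b's tower reads the residual only through `bgI ∕ bgMS`, which the history's residuals `θ.rzAtChi χ p s′`, `θ.rzAtChi χ p (init s′)` share (`rfl`;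
the smearing functions `φ_j` enter (2.23), not the spaces). [cite: Balaban1988Convergent, p.257, (2.27)(ii) p.259, (2.34)–(2.39) p.261] -/
theorem sect2TowerOfRecord_rzAt_succ_eq_init_of_Omega_empty {k : ℕ}
    (s : SeqOfRecord F θ.ν θ.τ9.M (gOfRecord₁₃Chi F N θ.toStage13Params χ p) p.K (k + 1)) (hΩ : s.Ω (k + 1) = ∅)
    (u : Sect2.TermValues (F.P p.K) (MatA N) (FluctV N) θ.τ9.M) :
    sect2TowerOfRecord F N (FluctV N) p.K (settingOfRecord₁₃Chi F N θ.toStage13Params χ p) (θ.rzAtChi χ p s) s u =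
      Sect2.towerOfTerms (settingOfRecord₁₃Chi F N θ.toStage13Params χ p) (θ.rzAtChi χ p s.init) θ.τ9.M s.init.Ω u := by
  rw [sect2TowerOfRecord_eq, ← seq_init_Ω_eq_of_Omega_empty s hΩ]
  rfl

end LawsCoPH

end Summit.QuantumFields.YangMills.Theorems.BalabanUVNodesN11NoExpansionGeneralStepLawsCoPHChi

end
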